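import Summits.AtomisticToContinuum.FouriersLaw.Theorems.BondHeatUncertaintyExtensiveSnapshotIrreversibilityEnergyWindowHessianSplitA

/-!
# Crux `ExtensiveSnapshotIrreversibility` (stmt-AtomisticToContinuum-9121): the far-side Duhamel split beneath S3 — no short-time rate

Cell decomp-a2c, lens «grading / quantitative ladder», generation 82 (critic row 1152 (d): the
assigned leaf is (SWM) `SkeletonWeightMoments`, DEEP-L · IDEA-NEEDED, byte-frozen).  This file does
NOT touch (SWM).  It records an ALTERNATIVE decomposition of the kernel leaf S3
`KernelTemperatureLipschitz` (time-ONE kernel of the pinned chain `|δ|`-Lipschitz in the bath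
temperatures `T ± δ/2`, weights `e^{θH} → e^{θ'H}`) in which NO short-time smoothing RATE occurs —
the grade of the small-time ladder that made (SWM) necessary is shown to be an artefact of the g75
cut, not of S3.

THE OBSERVATION.  The g75 split (part M, `…EnergyWindowKernelDuhamelSplit`) differentiates the
Duhamel path `Φ(s) = P^δ_s P^0_{1−s} h (z)`, `Φ' = (γδ/2)(F_0 − F_{N−1})`,
`F_b(s) = ∫ ∂_{p_b}(∂_{p_b} P^0_{1−s} h) dP^δ_s(z)`, and for EVERY `s ∈ (0,1)` puts ONE momentum
derivative on each factor: (G1) `|∂_{p_b} P^0_r h| ≲ r^{-a} e^{θ₁H}` and (G1*)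
`|∫ ∂_{p_b} g dP^δ_s| ≲ s^{-b₀} M e^{θ₂H}`, with `a, b₀ < 1` so that `s^{-b₀}(1−s)^{-a}` is
integrable.  Both estimates are SHORT-TIME smoothing estimates at the sharp hypoelliptic grade
(`a = b₀ = ½` expected), and beneath them the record needs (SWM) — sharp small-time moments of the
Malliavin integration-by-parts weights for `N ≥ 3`, not in print (DEEP-L · IDEA-NEEDED, census F8).
But S3 lives at time ONE: at every `s ∈ (0,1)` one of the two factors is at time `≥ ½`.  Put BOTH
derivatives on that factor:

* `s ∈ (0, ½]`: `r = 1 − s ∈ [½, 1)` and `|∂²_{p_b} P^0_r h (w)| ≤ C e^{θ'H(w)}` — a FIXED-TIME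
  second-order smoothing bound of the equal-temperature semigroup on `r ∈ [½, 1]` (leaf (G2)) —
  then CEHR (3.4) `∫ e^{θ'H} dP^δ_s(z) ≤ e^{2γθ'T} e^{θ'H(z)}` (tree,
  `integrable_and_abs_integral_transitionKernel_le`);
* `s ∈ [½, 1)`: both derivatives go onto the perturbed kernel `P^δ_s(z,·)`, `s ≥ ½`, by a double
  integration by parts: `|∫ ∂²_{p_b} G dP^δ_s(z)| ≤ C M e^{θ'H(z)}` for `G ∈ C²`, `|G| ≤ M e^{θH}`
  (leaf (G2*)), applied to `G = P^0_{1−s} h` with `M = e^{2γθT}` (CEHR (3.4), tree) and `G ∈ C²`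
  (leaf (R2)).

Then `|Φ'| ≤ γ|δ| B e^{θ'H(z)}` is BOUNDED on `(0,1)` — no singular endpoint, no `rpow`, no
`a, b₀` — and the fundamental theorem of calculus along (Dˢ) gives S3ˢ, hence S3
(`kernelTemperatureLipschitz_of_smooth`, tree).

PIECES (typed in part A; all WEAKER than the summit: fixed `N`, time `≤ 1`, no steady state, no
`N → ∞`; none EQUIV to S3 — probes `probes/MustFailH.lean`, `probes/BC7ProbeH.lean`):
* (Dˢ) `KernelTemperatureDuhamelSmooth` — tree, unchanged (hands; only (ii)–(iv) are used here).
* (R2) `EqualTemperatureOrbitSmooth` — `P^0_r h ∈ C²` for `h ∈ C_c^∞`, `r > 0`.  [NEW · WEAKER ·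
  PROVED in part A (`equalTemperatureOrbitSmooth`): `u_r(w) = ∫ p(r,w,y) h(y) dy` differentiated
  under the integral sign to all orders, `p` the jointly smooth density of the tree
  (`IsTransitionDensity`, `isTransitionDensity_exists`, CEHR Prop 3.2 PROVED in the tree from
  Hörmander's theorem); `h`-free constants are NOT asserted and not needed.]
* (G2) `EqualTemperatureBathHessian` — `|∂²_{p_b} P^0_r h(w)| ≤ C e^{θ'H(w)}` for `r ∈ [½,1]`,
  `h ∈ C_c^∞`, `|h| ≤ e^{θH}`, bath sites `b`.  [NEW · WEAKER · ATTACKABLE-L: second-order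
  Bismut–Malliavin formula at a FIXED positive time, `∂²P_r h(w) = E[h(X_r^w) Θ₂]` with
  `‖Θ₂‖_{L^q} ≤ C e^{εH(w)}` from (i) inverse moments of the Malliavin matrix of the chain at time
  `r ≥ ½` with Lyapunov-weighted dependence on the start (HairerMattingly2011spde Thm 6.7 —
  additive noise, polynomial drift, `P(⟨φ,M_tφ⟩ ≤ ε|φ|²) ≤ C Ψ(u₀)^{θp} ε^p`; KusuokaStroock1985),
  (ii) moments of the first three variations of the flow with `e^{εH}` weights (the tree engine of
  parts S/T, `FlowJacobianMoment`), (iii) Hölder with CEHR (3.4) for `h(X_r)`, `pθ < 1/T`.  NO RATE: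
  the constant may blow up as `r ↓ 0` in any manner.]
* (G2*) `PerturbedKernelHessianIBP` — `|∫ ∂²_{p_b} G dP^δ_s(z)| ≤ C M e^{θ₂H(z)}` for `s ∈ [½,1]`,
  `|δ| < δ₀`, `G ∈ C²`, `|G| ≤ M e^{θ₁H}`.  [NEW · WEAKER · ATTACKABLE-L: the same Malliavin matrix
  at time `s ≥ ½` for the two-temperature chain (uniform in `|δ| < δ₀`), second-order Skorokhod
  weight `H_{(b,b)}` (Nualart2006 Prop 2.1.4, §2.3), i.e. the weighted `W^{2,1}` bound
  `∫ e^{θ₁H(y)} (|∂_{y_b} p| + |∂²_{y_b} p|)(s,z,y) dy ≤ C e^{θ₂H(z)}` of the smooth density, and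
  the truncation `G χ_R` of part R (`ewCutoff`; the cross term `2 ∂G ∂χ_R` is removed by one more
  integration by parts, so no bound on `∂G` is needed; if `∂²_{p_b}G ∉ L¹(P^δ_s(z,·))` the Bochner
  integral is `0`).  NO RATE.]

THEOREMS (0 sorry): ★ `kernelTemperatureLipschitzSmooth_of_hessianSplit :
(Dˢ) → (R2) → (G2) → (G2*) → S3ˢ` (the structural lemma); ★ (R2) `equalTemperatureOrbitSmooth`
(part A); hence ★ `kernelTemperatureLipschitz_of_hessianSplit : (Dˢ) → (G2) → (G2*) → S3`, the
junction `K_fix ⟸ A0 ∧ A2 ∧ (Dˢ) ∧ (G2) ∧ (G2*) ∧ A3p ∧ A4` (`snapshotKLUpperExpansion_of_atoms₈H`)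
and `energyWindowControl_of_atoms₈H` — THREE open leaves beneath K_fix's kernel half, one of them
the hands' (Dˢ).

WHY THIS IS NOVEL (relative to the cell's record, parts M–W): every previous cut beneath S3 — (G1),
(G1*), their density cores (G1ᶜ)/(G1*ᶜ), the test-class forms (G1ℓ)/(G1*ᶜᶜ), and the skeleton
programme (SWM) ⟹ both — is a SMALL-TIME estimate whose exponent must be `< 1`; the harmonic
calibration (g80) shows the exponent is exactly `½`, so the line was typed at the SHARP grade of the
small-time ladder, where the `N ≥ 3` anharmonic estimate is not in print.  The far-side split
re-grades the same Duhamel identity at the LOWEST grade — finiteness at a fixed positive time —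
where the inputs are the classical fixed-time Malliavin–Hörmander estimates with Lyapunov control.
(SWM) is bypassed, not restated: it stays on the record as the (G1ℓ)/(G1*ᶜᶜ) route (part W).

WHY EACH NEW PIECE IS STRICTLY WEAKER THAN THE SUMMIT: (R2), (G2), (G2*) are statements about the
finite-`N` transition kernel on the time window `(0,1]`; the summit (Fourier's law for the chain)
quantifies the `N → ∞` steady-state conductivity; none of the three mentions a steady state.  They
do not imply S3 one or two at a time (probes), and S3 (an `O(|δ|)` statement at time one for all
measurable `h`) implies none of them by a tactic battery (probes).

References: N. Cuneo, J.-P. Eckmann, M. Hairer, L. Rey-Bellet, EJP 23 (2018) no. 55, §3 (3.2),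
(3.4), Prop 3.2; M. Hairer, J. C. Mattingly, EJP 16 (2011) 658–738, Thm 6.7; S. Kusuoka,
D. Stroock, J. Fac. Sci. Univ. Tokyo IA 32 (1985) 1–76; D. Nualart, The Malliavin Calculus and
Related Topics (2006), Prop 2.1.4, §2.3; J.-P. Eckmann, M. Hairer, Comm. Math. Phys. 212 (2000).
-/

noncomputable section

namespace Summit.AtomisticToContinuum.FouriersLaw.Theorems.ExtensiveSnapshotIrreversibility.EnergyWindow

open MeasureTheory ProbabilityTheory Filter Topology Real intervalIntegral
open scoped ENNReal NNReal ContDiff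
open Literature.MathematicalPhysics.KineticTheory.HeatConduction
open Literature.Probability.Process

/-! ## 1. ★ `(Dˢ) ∧ (R2) ∧ (G2) ∧ (G2*) ⟹ S3ˢ`: the far-side split, no singular endpoint -/

/-- ★ **`(Dˢ) → (R2) → (G2) → (G2*) → S3ˢ`.**  For `0 < s ≤ ½` the near-side Hessian bound (G2) at
`r = 1 − s ∈ [½, 1)` and CEHR (3.4) for `P^δ_s(z,·)` bound the Duhamel integrand by
`K₁ e^{2γθ'T} e^{θ'H(z)}`; for `½ < s < 1` the far-side double integration by parts (G2*) at time
`s`, applied to `G = P^0_{1−s} h ∈ C²` ((R2)) with `|G| ≤ e^{2γθT} e^{θH}` (CEHR (3.4)), bounds it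
by `K₂ e^{2γθT} e^{θ'H(z)}`.  So `|Φ'| ≤ γ|δ| B e^{θ'H(z)}` on `(0,1)` with
`B = K₁ e^{2γθ'T} + K₂ e^{2γθT}`, and the fundamental theorem of calculus along (Dˢ) gives
`|P^δ_1 h(z) − P^0_1 h(z)| ≤ γ B |δ| e^{θ'H(z)}` (`δ₀` shrunk below `min(T, 1/θ' − T)` so that both
bath temperatures lie in `(0, 1/θ')`).
[cite: CuneoEckmannHairerReyBellet2018, §3 eq. (3.2), (3.4)] -/
theorem kernelTemperatureLipschitzSmooth_of_hessianSplit (hD : KernelTemperatureDuhamelSmooth)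
    (hR : EqualTemperatureOrbitSmooth) (hG : EqualTemperatureBathHessian)
    (hI : PerturbedKernelHessianIBP) : KernelTemperatureLipschitzSmooth := by
  intro ω₂ lam β γ hω hl hβ hγ T hT N hN θ θ' hθ hθθ' hθ'1
  have hN0 : 0 < N := by omega
  have hθ1 : θ < 1 / T := hθθ'.trans hθ'1
  have hθ'0 : 0 < θ' := hθ.trans hθθ'
  have hθ0 : θ < 1 / max T T := by rwa [max_self]
  have hθ'T : T < 1 / θ' := by
    rw [lt_div_iff₀ hθ'0]
    have := (lt_div_iff₀ hT).1 hθ'1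
    linarith [mul_comm θ' T]
  obtain ⟨δD, hδD, hDu⟩ := hD ω₂ lam β γ hω hl hβ hγ T hT N hN θ hθ hθ1
  obtain ⟨C₁, hG1⟩ := hG ω₂ lam β γ hω hl hβ hγ T hT N hN θ θ' hθ hθθ' hθ'1
  obtain ⟨δI, C₂, hδI, hI1⟩ := hI ω₂ lam β γ hω hl hβ hγ T hT N hN θ θ' hθ hθθ' hθ'1
  set Hm := (pinnedChain ω₂ lam β γ).hamiltonian N with hHm
  -- nonnegative majorants of the two constants and the CEHR (3.4) time factors on `[0, 1]`
  set K₁ : ℝ := max C₁ 0 with hK₁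
  set K₂ : ℝ := max C₂ 0 with hK₂
  have hK₁0 : 0 ≤ K₁ := le_max_right _ _
  have hK₂0 : 0 ≤ K₂ := le_max_right _ _
  set A₁ : ℝ := Real.exp (θ' * γ * (T + T) * 1) with hA₁
  set A₂ : ℝ := Real.exp (θ * γ * (T + T) * 1) with hA₂
  have hA₁0 : 0 < A₁ := Real.exp_pos _
  have hA₂0 : 0 < A₂ := Real.exp_pos _
  set B : ℝ := K₁ * A₁ + K₂ * A₂ with hB
  have hB0 : 0 ≤ B := by positivity
  refine ⟨min (min δD δI) (min T (1 / θ' - T)), γ * B,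
    lt_min (lt_min hδD hδI) (lt_min hT (by linarith)), fun δ hδ z g hgC hgK hg => ?_⟩
  have hδD' : |δ| < δD := (hδ.trans_le (min_le_left _ _)).trans_le (min_le_left _ _)
  have hδI' : |δ| < δI := (hδ.trans_le (min_le_left _ _)).trans_le (min_le_right _ _)
  have hδT : |δ| < T := (hδ.trans_le (min_le_right _ _)).trans_le (min_le_left _ _)
  have hδθ : |δ| < 1 / θ' - T := (hδ.trans_le (min_le_right _ _)).trans_le (min_le_right _ _)
  have hδabs := abs_lt.1 hδT
  have hδabs' := abs_lt.1 hδθ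
  -- both bath temperatures in `(0, 1/θ')`
  have hL : 0 < T + δ / 2 := by linarith
  have hRt : 0 < T - δ / 2 := by linarith
  have hmaxpos : 0 < max (T + δ / 2) (T - δ / 2) := lt_max_of_lt_left hL
  have hmaxlt : max (T + δ / 2) (T - δ / 2) < 1 / θ' := max_lt (by linarith) (by linarith)
  have hθ'δ : θ' < 1 / max (T + δ / 2) (T - δ / 2) := by
    rw [lt_div_iff₀ hmaxpos]
    have := (lt_div_iff₀ hθ'0).1 hmaxlt
    linarith [mul_comm θ' (max (T + δ / 2) (T - δ / 2))]
  have hgm : Measurable g := hgC.continuous.measurable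
  have hg1 : ∀ y, |g y| ≤ 1 * Real.exp (θ * Hm y) := fun y => by rw [one_mul]; exact hg y
  obtain ⟨-, hz⟩ := hDu δ hδD' g hgC hgK hg
  obtain ⟨hcont, hFc, hder⟩ := hz z
  set E : ℝ := Real.exp (θ' * Hm z) with hE
  have hE0 : 0 < E := Real.exp_pos _
  set FL := duhamelIntegrand ω₂ lam β γ T δ N (leftBath N hN) g z with hFL
  set FR := duhamelIntegrand ω₂ lam β γ T δ N (rightBath N hN) g z with hFR
  -- the BOUNDED pointwise majorant of the Duhamel integrands on `0 < s < 1`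
  have hF : ∀ s : ℝ, 0 < s → s < 1 → ∀ b : Fin N, (b = leftBath N hN ∨ b = rightBath N hN) →
      |duhamelIntegrand ω₂ lam β γ T δ N b g z s| ≤ B * E := by
    intro s hs0 hs1 b hb
    have hr0 : 0 < 1 - s := by linarith
    have hr1 : 1 - s ≤ 1 := by linarith
    by_cases hs : s ≤ 1 / 2
    · -- NEAR SIDE: both derivatives on `u_{1−s}`, `1 − s ∈ [½, 1)`, then CEHR (3.4) for `P^δ_s`
      have hr : 1 / 2 ≤ 1 - s := by linarith
      have hpt : ∀ w, |partialP b (partialP b (eqKernelFun ω₂ lam β γ T N g (1 - s))) w| ≤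
          K₁ * Real.exp (θ' * Hm w) := fun w =>
        (hG1 (1 - s) hr hr1 g hgC hgK hg b hb w).trans
          (mul_le_mul_of_nonneg_right (le_max_left _ _) (Real.exp_pos _).le)
      have hmeas : Measurable (partialP b (partialP b (eqKernelFun ω₂ lam β γ T N g (1 - s)))) :=
        measurable_partialP_partialP_of_contDiff_two b
          (hR ω₂ lam β γ hω hl hβ hγ T hT N hN0 g hgC hgK (1 - s) hr0)
      have h34 := (integrable_and_abs_integral_transitionKernel_le hω hl hβ hγ hN0 hL hRt hθ'0
        hθ'δ s.toNNReal z hK₁0 hmeas hpt).2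
      have htime : Real.exp (θ' * γ * (T + δ / 2 + (T - δ / 2)) * (s.toNNReal : ℝ)) ≤ A₁ := by
        rw [hA₁, Real.coe_toNNReal _ hs0.le, Real.exp_le_exp,
          show θ' * γ * (T + δ / 2 + (T - δ / 2)) * s = θ' * γ * (T + T) * s by ring]
        exact mul_le_mul_of_nonneg_left hs1.le (by positivity)
      unfold duhamelIntegrand pertKernel
      calc |∫ w, partialP b (partialP b (eqKernelFun ω₂ lam β γ T N g (1 - s))) w
              ∂(pinnedChain ω₂ lam β γ).transitionKernel N (T + δ / 2) (T - δ / 2) s.toNNReal z|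
          ≤ K₁ * (Real.exp (θ' * γ * (T + δ / 2 + (T - δ / 2)) * (s.toNNReal : ℝ)) * E) := h34
        _ ≤ K₁ * (A₁ * E) := by gcongr
        _ ≤ B * E := by rw [hB]; nlinarith [mul_nonneg hK₂0 hA₂0.le]
    · -- FAR SIDE: both derivatives on `P^δ_s(z,·)`, `s ∈ (½, 1)`, for `G = u_{1−s} ∈ C²`
      have hs' : 1 / 2 < s := not_le.1 hs
      have hC2 : ContDiff ℝ 2 (eqKernelFun ω₂ lam β γ T N g (1 - s)) :=
        hR ω₂ lam β γ hω hl hβ hγ T hT N hN0 g hgC hgK (1 - s) hr0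
      have hu : ∀ w, |eqKernelFun ω₂ lam β γ T N g (1 - s) w| ≤ A₂ * Real.exp (θ * Hm w) := by
        intro w
        have h := (integrable_and_abs_integral_transitionKernel_le hω hl hβ hγ hN0 hT hT hθ hθ0
          (1 - s).toNNReal w zero_le_one hgm hg1).2
        have htime : Real.exp (θ * γ * (T + T) * ((1 - s).toNNReal : ℝ)) ≤ A₂ := by
          rw [hA₂, Real.coe_toNNReal _ hr0.le, Real.exp_le_exp]
          exact mul_le_mul_of_nonneg_left hr1 (by positivity)
        unfold eqKernelFun
        calc |∫ y, g y ∂(pinnedChain ω₂ lam β γ).transitionKernel N T T (1 - s).toNNReal w|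
            ≤ 1 * (Real.exp (θ * γ * (T + T) * ((1 - s).toNNReal : ℝ)) *
                Real.exp (θ * Hm w)) := h
          _ ≤ 1 * (A₂ * Real.exp (θ * Hm w)) := by gcongr
          _ = A₂ * Real.exp (θ * Hm w) := one_mul _
      have h := hI1 δ hδI' s hs'.le hs1.le b hb A₂ hA₂0.le _ hC2 hu z
      unfold duhamelIntegrand
      calc |∫ w, partialP b (partialP b (eqKernelFun ω₂ lam β γ T N g (1 - s))) w
              ∂pertKernel ω₂ lam β γ T δ N s z|
          ≤ C₂ * A₂ * E := h
        _ ≤ K₂ * A₂ * E := by gcongr; exact le_max_left _ _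
        _ ≤ B * E := by rw [hB]; nlinarith [mul_nonneg hK₁0 hA₁0.le]
  have hpt : ∀ s : ℝ, 0 < s → s < 1 → ‖FL s - FR s‖ ≤ 2 * B * E := by
    intro s hs0 hs1
    rw [Real.norm_eq_abs]
    have hLb := hF s hs0 hs1 (leftBath N hN) (Or.inl rfl)
    have hRb := hF s hs0 hs1 (rightBath N hN) (Or.inr rfl)
    calc |FL s - FR s| ≤ B * E + B * E := (abs_sub _ _).trans (add_le_add hLb hRb)
      _ = 2 * B * E := by ring
  -- a.e. form on `uIoc 0 1` (the endpoint `s = 1` is a null set: pass to `Ioo 0 1`)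
  have hae : ∀ᵐ s ∂(volume.restrict (Set.uIoc (0 : ℝ) 1)),
      ‖FL s - FR s‖ ≤ (fun _ : ℝ => 2 * B * E) s := by
    rw [Set.uIoc_of_le zero_le_one, ← Measure.restrict_congr_set Ioo_ae_eq_Ioc]
    filter_upwards [ae_restrict_mem measurableSet_Ioo] with s hs
    exact hpt s hs.1 hs.2
  have hFm :
      AEStronglyMeasurable (fun s => FL s - FR s) (volume.restrict (Set.uIoc (0 : ℝ) 1)) := by
    rw [Set.uIoc_of_le zero_le_one, ← Measure.restrict_congr_set Ioo_ae_eq_Ioc]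
    exact ((hFc _ (Or.inl rfl)).sub (hFc _ (Or.inr rfl))).aestronglyMeasurable
      measurableSet_Ioo
  have hci : IntervalIntegrable (fun _ : ℝ => 2 * B * E) volume 0 1 := intervalIntegrable_const
  have hFi : IntervalIntegrable (fun s => FL s - FR s) volume 0 1 := hci.mono_fun' hFm hae
  -- the fundamental theorem of calculus along the Duhamel path: NO singular endpoint
  have hftc := intervalIntegral.integral_eq_sub_of_hasDerivAt_of_le zero_le_one hcont
    (fun s hs => hder s hs) (hFi.const_mul (γ * δ / 2))
  rw [duhamelPath_zero hω hl hβ hγ, duhamelPath_one hω hl hβ hγ,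
    intervalIntegral.integral_const_mul] at hftc
  have hint : ‖∫ s in (0 : ℝ)..1, (FL s - FR s)‖ ≤ |∫ _ in (0 : ℝ)..1, 2 * B * E| :=
    intervalIntegral.norm_integral_le_abs_of_norm_le hae hci
  rw [intervalIntegral.integral_const, sub_zero, one_smul, Real.norm_eq_abs,
    abs_of_nonneg (by positivity : (0 : ℝ) ≤ 2 * B * E)] at hint
  -- assemble
  rw [← hftc, abs_mul, show |γ * δ / 2| = γ / 2 * |δ| by
    rw [abs_div, abs_mul, abs_of_pos hγ, abs_two]; ring]
  calc γ / 2 * |δ| * |∫ s in (0 : ℝ)..1, (FL s - FR s)|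
      ≤ γ / 2 * |δ| * (2 * B * E) := mul_le_mul_of_nonneg_left hint (by positivity)
    _ = γ * B * |δ| * E := by ring

/-! ## 2. The junctions ((R2) discharged by part A) -/

/-- ★ **`(Dˢ) → (G2) → (G2*) → S3`** ((R2) is the theorem `equalTemperatureOrbitSmooth`; then the
tree's `S3ˢ → S3`, `kernelTemperatureLipschitz_of_smooth`). [folklore] -/
theorem kernelTemperatureLipschitz_of_hessianSplit (hD : KernelTemperatureDuhamelSmooth)
    (hG : EqualTemperatureBathHessian) (hI : PerturbedKernelHessianIBP) :
    KernelTemperatureLipschitz :=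
  kernelTemperatureLipschitz_of_smooth
    (kernelTemperatureLipschitzSmooth_of_hessianSplit hD equalTemperatureOrbitSmooth hG hI)

/-- **Glue `A0 → A2 → (Dˢ) → (G2) → (G2*) → A3p → A4 → (W)`.** [folklore] -/
theorem energyWindowControl_of_atoms₈H (h0 : NessGibbsReweighting) (h2 : NessOddLogRatioBound)
    (hD : KernelTemperatureDuhamelSmooth) (hG : EqualTemperatureBathHessian)
    (hI : PerturbedKernelHessianIBP) (h3p : NessFloorMeanValue) (h4 : NessLinearResponseL2) :
    EnergyWindowControl :=
  energyWindowControl_of_atoms₅K h0 h2 (kernelTemperatureLipschitz_of_hessianSplit hD hG hI) h3p h4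

/-- ★ **The junction `K_fix ⟸ A0 ∧ A2 ∧ (Dˢ) ∧ (G2) ∧ (G2*) ∧ A3p ∧ A4`.** [folklore] -/
theorem snapshotKLUpperExpansion_of_atoms₈H (h0 : NessGibbsReweighting)
    (h2 : NessOddLogRatioBound) (hD : KernelTemperatureDuhamelSmooth)
    (hG : EqualTemperatureBathHessian) (hI : PerturbedKernelHessianIBP)
    (h3p : NessFloorMeanValue) (h4 : NessLinearResponseL2) : SnapshotKLUpperExpansion :=
  snapshotKLUpperExpansion_of_atoms₅K h0 h2 (kernelTemperatureLipschitz_of_hessianSplit hD hG hI)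
    h3p h4

end Summit.AtomisticToContinuum.FouriersLaw.Theorems.ExtensiveSnapshotIrreversibility.EnergyWindow

end
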